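import Summits.CriticalPhenomena.Ising3D.TaylorRegionDeltaRowsS
import Mathlib.Tactic.Linarith
import Mathlib.Tactic.Positivity
import Mathlib.Tactic.Ring
import HarnessLib

/-!
# S-format δ-tables: PIECEWISE containment of the signed second-order slot, one kernel table per decision (T2′ (a′), lead RULING R26-κ)
(cell `pub-ising3x`, seat boot-1 gen 19, 2026-08-24)

HONEST FRAMING: lottery ticket; floor = tightest certified 3D Ising CFT bounds; no exact-solution
claim without a proof. Island framing: certified exclusion region at stated derivative order and
assumptions; not a determination of the 3D Ising critical exponents beyond that.

WHY. The S-format literal route (`tabOKS … 2 = subset2I (deltaT2S …) T.2.2`, TaylorRegionDeltaRowsS / TaylorTableHeadDeltaRowsS) asks the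
kernel to evaluate `deltaT2S` — THIRTEEN `kernelPDLI2` tables — inside ONE `decide`; on cand-T-sized objects this trips the kernel's memory
guard (boot-1 g19 smoke of `tRS2048`, 2026-08-24: «(kernel) excessive memory consumption detected»; the Booleans are TRUE; a four-table piece
still tripped it on one node). Nothing landed is unsound; the hypothesis is merely not kernel-DECIDABLE in one piece. This file is ADDITIVE:

* `Km … i` (i = 0 … 12) — the thirteen kernel tables of `deltaT2S` in order of appearance, `KmR` their real shadows, and
  `deltaT2S = combineS S W (Km …)` / `deltaT2SR δ = combineSR δ (KmR … δ)` BY `rfl`, where `combineS` is `deltaT2S`'s own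
  `add2I` / `smul2MI` tree over an arbitrary family of tables (so literals can replace the K's without re-association);
* the slot-2 containment as a PROPOSITION `∀ |δ| ≤ W, deltaT2SR δ ∈ T₂₂` (stated inline), obtained EITHER from the old one-piece Boolean
  (`tabOK2P_of_tabOKS`) OR from thirteen single-table containments `kpieceOKS … PL i` (computed `Km … i` ⊆ literal `PL[i]`, ONE kernel table
  per decision) plus ONE literal-only containment `ksumOKS S W PL T` (`combineS` of the literals ⊆ `T.2.2`) — `slot2_of_kpieces`;
* `pmem3_tripLSP` = `pmem3_tripLS` with the slot-2 hypothesis in that propositional form; literal containers `IPieceL` (a list of 13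
  tables) / `IPieceL5` / `IPieceL4`. The row contracts built on them (`OddHeadRowsΔ.validΔ_of_litSP` / `HeadRowsΔ.validΔ_of_litSP`, data-level
  `kpieceOKcS` / `ksumOKcS`) live in the companion module `TaylorTableHeadDeltaRowsSP`. [folklore]
-/

namespace Summit.CriticalPhenomena.Ising3D

open Finset Set
open Literature.Analysis.ValidatedNumerics Literature.Analysis.ValidatedNumerics.PolyMP
open Literature.Analysis.ValidatedNumerics.NumericsMP (MI)
open Literature.MathematicalPhysics.QuantumFieldTheory.ConformalBootstrap3D

/-! ### The thirteen kernel tables of `deltaT2S` and their real shadows -/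

/-- The `i`-th kernel table of `deltaT2S` in order of appearance: `K C₁C₁, K C₀C₂, K C₂C₀ | K C₁C₂, K C₂C₁, K C₀B₃, K B₃C₀ | K C₂C₂, K C₁B₃,
K B₃C₁ | K C₂B₃, K B₃C₂ | K B₃B₃` (`i ≥ 12 ↦` the last). [folklore] -/
def Km (S : ℕ) (cQ : ℕ × ℕ → ℚ) (σQ : ℚ) (s₀ W ccQ : ℚ) (l : List (ℕ × ℕ)) (i : ℕ) : IPoly2 :=
  let C0 := sigmaC0 S s₀
  let C1 := sigmaC1 S s₀
  let C2 := sigmaC2 S s₀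
  let B3 := sigmaRemB3 S s₀ W
  let K := fun A B => kernelPDLI2 S cQ σQ A B ccQ l
  match i with
  | 0 => K C1 C1
  | 1 => K C0 C2
  | 2 => K C2 C0
  | 3 => K C1 C2
  | 4 => K C2 C1
  | 5 => K C0 B3
  | 6 => K B3 C0
  | 7 => K C2 C2
  | 8 => K C1 B3
  | 9 => K B3 C1
  | 10 => K C2 B3
  | 11 => K B3 C2
  | _ => K B3 B3

/-- Real shadow of the `i`-th kernel table at a given `δ`. [folklore] -/
noncomputable def KmR (cQ : ℕ × ℕ → ℚ) (σQ : ℚ) (s₀ ccQ : ℚ) (l : List (ℕ × ℕ)) (δ : ℝ) (i : ℕ) : List (List ℝ) :=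
  let c : ℕ × ℕ → ℝ := fun ab => (cQ ab : ℝ)
  let K := fun A B => kernelPDLG c l A B (σQ : ℝ) (ccQ : ℝ)
  let C0 := sigC0 s₀
  let C1 := sigC1 s₀
  let C2 := sigC2 s₀
  let R3 := fun i => sigmaRho3 s₀ i δ
  match i with
  | 0 => K C1 C1
  | 1 => K C0 C2
  | 2 => K C2 C0
  | 3 => K C1 C2
  | 4 => K C2 C1
  | 5 => K C0 R3
  | 6 => K R3 C0
  | 7 => K C2 C2
  | 8 => K C1 R3
  | 9 => K R3 C1
  | 10 => K C2 R3
  | 11 => K R3 C2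
  | _ => K R3 R3

/-- `deltaT2S`'s own `add2I` / `smul2MI` tree over an arbitrary family of thirteen tables (the K's, or literals replacing them). [folklore] -/
def combineS (S : ℕ) (W : ℚ) (P : ℕ → IPoly2) : IPoly2 :=
  add2I (add2I (P 0) (add2I (P 1) (P 2)))
    (add2I (smul2MI S (enclQ S (-W) W) (add2I (add2I (P 3) (P 4)) (add2I (P 5) (P 6))))
      (add2I (smul2MI S (enclQ S 0 (W ^ 2)) (add2I (P 7) (add2I (P 8) (P 9))))
        (add2I (smul2MI S (enclQ S (-(W ^ 3)) (W ^ 3)) (add2I (P 10) (P 11)))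
          (smul2MI S (enclQ S 0 (W ^ 4)) (P 12)))))

/-- The same tree on the real side at a given `δ`. [folklore] -/
noncomputable def combineSR (δ : ℝ) (Q : ℕ → List (List ℝ)) : List (List ℝ) :=
  add2 (add2 (Q 0) (add2 (Q 1) (Q 2)))
    (add2 (smul2 δ (add2 (add2 (Q 3) (Q 4)) (add2 (Q 5) (Q 6))))
      (add2 (smul2 (δ ^ 2) (add2 (Q 7) (add2 (Q 8) (Q 9))))
        (add2 (smul2 (δ ^ 3) (add2 (Q 10) (Q 11)))
          (smul2 (δ ^ 4) (Q 12)))))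

/-- **`deltaT2S` is `combineS` of its thirteen kernel tables** (definitional). [folklore] -/
theorem deltaT2S_eq_combineS (S : ℕ) (cQ : ℕ × ℕ → ℚ) (σQ : ℚ) (s₀ W ccQ : ℚ) (l : List (ℕ × ℕ)) :
    deltaT2S S cQ σQ s₀ W ccQ l = combineS S W (Km S cQ σQ s₀ W ccQ l) := rfl

/-- The real shadow likewise (definitional). [folklore] -/
theorem deltaT2SR_eq_combineSR (cQ : ℕ × ℕ → ℚ) (σQ : ℚ) (s₀ ccQ : ℚ) (l : List (ℕ × ℕ)) (δ : ℝ) :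
    deltaT2SR cQ σQ s₀ ccQ l δ = combineSR δ (KmR cQ σQ s₀ ccQ l δ) := rfl

/-! ### Soundness: each kernel table contains its real shadow; the tree preserves membership -/

/-- **Each kernel table of `deltaT2S` contains its real shadow** for `|δ| ≤ W` (`i < 13`). [folklore] -/
theorem pmem2_Km {S : ℕ} (hS : 0 < S) (cQ : ℕ × ℕ → ℚ) (σQ : ℚ) (s₀ : ℚ) {W : ℚ} (hW : 0 ≤ W) (ccQ : ℚ) (l : List (ℕ × ℕ))
    {δ : ℝ} (hδ : |δ| ≤ W) (i : ℕ) (hi : i < 13) : PMem2 S (KmR cQ σQ s₀ ccQ l δ i) (Km S cQ σQ s₀ W ccQ l i) := by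
  have h0 : ∀ i, MI.mem S (sigC0 s₀ i) (sigmaC0 S s₀ i) := mem_sigmaC0 S s₀
  have h1 : ∀ i, MI.mem S (sigC1 s₀ i) (sigmaC1 S s₀ i) := mem_sigmaC1 S s₀
  have h2 : ∀ i, MI.mem S (sigC2 s₀ i) (sigmaC2 S s₀ i) := mem_sigmaC2 S s₀
  have hρ : ∀ i, MI.mem S (sigmaRho3 s₀ i δ) (sigmaRemB3 S s₀ W i) := fun i => mem_sigmaRemB3 S s₀ hW i hδ
  interval_cases i <;> unfold KmR Km
  · exact pmem2_kernelPDLI2 hS cQ σQ ccQ l h1 h1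
  · exact pmem2_kernelPDLI2 hS cQ σQ ccQ l h0 h2
  · exact pmem2_kernelPDLI2 hS cQ σQ ccQ l h2 h0
  · exact pmem2_kernelPDLI2 hS cQ σQ ccQ l h1 h2
  · exact pmem2_kernelPDLI2 hS cQ σQ ccQ l h2 h1
  · exact pmem2_kernelPDLI2 hS cQ σQ ccQ l h0 hρ
  · exact pmem2_kernelPDLI2 hS cQ σQ ccQ l hρ h0
  · exact pmem2_kernelPDLI2 hS cQ σQ ccQ l h2 h2
  · exact pmem2_kernelPDLI2 hS cQ σQ ccQ l h1 hρ
  · exact pmem2_kernelPDLI2 hS cQ σQ ccQ l hρ h1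
  · exact pmem2_kernelPDLI2 hS cQ σQ ccQ l h2 hρ
  · exact pmem2_kernelPDLI2 hS cQ σQ ccQ l hρ h2
  · exact pmem2_kernelPDLI2 hS cQ σQ ccQ l hρ hρ

/-- **The tree preserves membership**: thirteen memberships and `|δ| ≤ W` give membership of `combineSR δ Q` in `combineS S W P`. [folklore] -/
theorem pmem2_combineS {S : ℕ} (hS : 0 < S) {W : ℚ} {δ : ℝ} (hδ : |δ| ≤ W) {Q : ℕ → List (List ℝ)} {P : ℕ → IPoly2}
    (h : ∀ i : ℕ, i < 13 → PMem2 S (Q i) (P i)) : PMem2 S (combineSR δ Q) (combineS S W P) := by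
  have hδW : -(W : ℝ) ≤ δ ∧ δ ≤ W := ⟨by linarith [neg_abs_le δ, hδ], by linarith [le_abs_self δ, hδ]⟩
  have hδI : MI.mem S δ (enclQ S (-W) W) := mem_enclQ S (by push_cast; exact hδW.1) (by exact_mod_cast hδW.2)
  have hsq : δ ^ 2 ≤ (W : ℝ) ^ 2 := by rw [← sq_abs]; exact pow_le_pow_left₀ (abs_nonneg δ) hδ 2
  have hδ2 : MI.mem S (δ ^ 2) (enclQ S 0 (W ^ 2)) := mem_enclQ S (by push_cast; positivity) (by exact_mod_cast hsq)
  have hcube : |δ ^ 3| ≤ (W : ℝ) ^ 3 := by rw [abs_pow]; exact pow_le_pow_left₀ (abs_nonneg δ) hδ 3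
  have hδ3 : MI.mem S (δ ^ 3) (enclQ S (-(W ^ 3)) (W ^ 3)) :=
    mem_enclQ S (by push_cast; linarith [neg_abs_le (δ ^ 3), hcube]) (by push_cast; linarith [le_abs_self (δ ^ 3), hcube])
  have h4 : δ ^ 4 ≤ (W : ℝ) ^ 4 := by
    have : δ ^ 4 = (δ ^ 2) ^ 2 := by ring
    rw [this, show (W : ℝ) ^ 4 = ((W : ℝ) ^ 2) ^ 2 by ring]
    exact pow_le_pow_left₀ (by positivity) hsq 2
  have hδ4 : MI.mem S (δ ^ 4) (enclQ S 0 (W ^ 4)) := mem_enclQ S (by push_cast; positivity) (by exact_mod_cast h4)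
  unfold combineSR combineS
  exact pmem2_add2I (pmem2_add2I (h 0 (by norm_num)) (pmem2_add2I (h 1 (by norm_num)) (h 2 (by norm_num))))
    (pmem2_add2I (pmem2_smul2MI hS hδI (pmem2_add2I (pmem2_add2I (h 3 (by norm_num)) (h 4 (by norm_num)))
        (pmem2_add2I (h 5 (by norm_num)) (h 6 (by norm_num)))))
      (pmem2_add2I (pmem2_smul2MI hS hδ2 (pmem2_add2I (h 7 (by norm_num)) (pmem2_add2I (h 8 (by norm_num)) (h 9 (by norm_num)))))
        (pmem2_add2I (pmem2_smul2MI hS hδ3 (pmem2_add2I (h 10 (by norm_num)) (h 11 (by norm_num))))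
          (pmem2_smul2MI hS hδ4 (h 12 (by norm_num))))))

/-! ### Slot-2 containment: from the one-piece Boolean (old route) OR from thirteen single-table pieces (new route) -/

/-- Old route: the one-piece Boolean `tabOKS … 2` gives the slot-2 containment `∀ |δ| ≤ W, deltaT2SR δ ∈ T₂₂`. [folklore] -/
theorem tabOK2P_of_tabOKS {S : ℕ} (hS : 0 < S) (c : ℕ × ℕ → ℚ) (σQ s₀ : ℚ) {W : ℚ} (hW : 0 ≤ W) (cc : ℚ) (l : List (ℕ × ℕ))
    {T : ITab3} (h2 : tabOKS S c σQ s₀ W cc l T 2 = true) :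
    ∀ δ : ℝ, |δ| ≤ W → PMem2 S (deltaT2SR c σQ s₀ cc l δ) T.2.2 := by
  intro δ hδ
  have h2' : subset2I (deltaT2S S c σQ s₀ W cc l) T.2.2 = true := h2
  exact pmem2_of_subset2I (pmem2_deltaT2S hS c σQ s₀ hW cc l hδ) h2'

/-- Literal container: the thirteen single-table literals of one component, as a list (entry `i` read with `getD i []`). [folklore] -/
abbrev IPieceL := List IPoly2

/-- Containment of the computed kernel table `i` in the literal `PL[i]` (ONE kernel table per decision). [folklore] -/
def kpieceOKS (S : ℕ) (c : ℕ × ℕ → ℚ) (σQ s₀ W cc : ℚ) (l : List (ℕ × ℕ)) (PL : IPieceL) (i : ℕ) : Bool :=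
  subset2I (Km S c σQ s₀ W cc l i) (PL.getD i [])

/-- Containment of `combineS` of the literals in the slot-2 literal (literals only; no kernel table is evaluated). [folklore] -/
def ksumOKS (S : ℕ) (W : ℚ) (PL : IPieceL) (T : ITab3) : Bool := subset2I (combineS S W fun i => PL.getD i []) T.2.2

/-- **New route (PIECEWISE)**: thirteen single-table containments and one literal containment give the slot-2 containment. [folklore] -/
theorem slot2_of_kpieces {S : ℕ} (hS : 0 < S) (c : ℕ × ℕ → ℚ) (σQ s₀ : ℚ) {W : ℚ} (hW : 0 ≤ W) (cc : ℚ) (l : List (ℕ × ℕ))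
    {PL : IPieceL} {T : ITab3} (hp : ∀ i : ℕ, i < 13 → kpieceOKS S c σQ s₀ W cc l PL i = true) (hs : ksumOKS S W PL T = true) :
    ∀ δ : ℝ, |δ| ≤ W → PMem2 S (deltaT2SR c σQ s₀ cc l δ) T.2.2 := by
  intro δ hδ
  rw [deltaT2SR_eq_combineSR]
  exact pmem2_of_subset2I
    (pmem2_combineS hS hδ fun i hi => pmem2_of_subset2I (pmem2_Km hS c σQ s₀ hW cc l hδ i hi) (hp i hi)) hs

/-- **The q-sum rows as a triple** with the slot-2 hypothesis in propositional form (`pmem3_tripLS` otherwise verbatim). [folklore] -/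
theorem pmem3_tripLSP {S : ℕ} (hS : 0 < S) (c : ℕ × ℕ → ℚ) (σQ s₀ : ℚ) {W : ℚ} (cc : ℚ) (l : List (ℕ × ℕ))
    {T : ITab3} (h0 : tabOKS S c σQ s₀ W cc l T 0 = true) (h1 : tabOKS S c σQ s₀ W cc l T 1 = true)
    (h2 : ∀ δ : ℝ, |δ| ≤ W → PMem2 S (deltaT2SR c σQ s₀ cc l δ) T.2.2) (N j : ℕ) {δ : ℝ} (hδ : |δ| ≤ W) :
    PMem3 S (qRowOfTable (deltaT0R c σQ s₀ cc l) N j, qRowOfTable (deltaT1R c σQ s₀ cc l) N j,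
        qRowOfTable (deltaT2SR c σQ s₀ cc l δ) N j) (tripL T N j) := by
  have h0' : subset2I (deltaT0 S c σQ s₀ cc l) T.1 = true := h0
  have h1' : subset2I (deltaT1 S c σQ s₀ cc l) T.2.1 = true := h1
  exact ⟨pmem_qRowOfTableI (pmem2_of_subset2I (pmem2_deltaT0 hS c σQ s₀ cc l) h0') N j,
    pmem_qRowOfTableI (pmem2_of_subset2I (pmem2_deltaT1 hS c σQ s₀ cc l) h1') N j,
    pmem_qRowOfTableI (h2 δ hδ) N j⟩

/-- Literal containers of the five odd components / the four even components (component order = `ITab3x5` / `proj4`). [folklore] -/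
abbrev IPieceL5 := IPieceL × IPieceL × IPieceL × IPieceL × IPieceL
/-- [folklore] -/
abbrev IPieceL4 := IPieceL × IPieceL × IPieceL × IPieceL

end Summit.CriticalPhenomena.Ising3D
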